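import Summits.QuantumFields.YangMills.Theorems.LuscherReductionDressedRitzPolyakovLiftUniversalityExists
import HarnessLib

/-!
# Route `LuscherReduction`, item `DressedRitz` (stmt-QuantumFields-20205), line «polyakovlift» — CORRECTED universality target (A):
# `ChannelUniversalityAt k` (scale-free in the fine AND in the one-site channel vectors) and its composition with the one-site shadow (B∃)

Support module (LEAD prover ym-lead-20205-polyakovlift g0; `--supports stmt-QuantumFields-20205`, helper).  ERRATUM to `UniversalityAt k`
(`…PolyakovLiftUniversality.lean`, p531904): its clauses (An) `|n^f_ii − n^o_ii| ≤ Cλ n^o_ii` and (A6) `|F μ₀ − G λ₀| ≤ …√(n^o n^o)` compare the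
fine dressed norms `n^f = ‖K_β^L u‖²` (scale `λ₀(β,L)^{2L}`) with the one-site shadow norms `n^o = ‖K_B^L w‖²` (scale `μ₀(B)^{2L}`) ADDITIVELY — not
invariant under independent rescaling of the two families, hence false as typed (the two top values are unrelated numbers) and NOT what universality
says.  The ratio clause (A5) was already scale-free.  The corrected target keeps (A5) and replaces (A6) by its NORMALISED form; (An) is not needed:

  (A5)  `d^f_ii · n^o_ii · μ₀ ≤ e^{Cλ²/L} · d^o_ii · n^f_ii · λ₀` and conversely — one-step effective RATIOS `ρ/λ₀` vs `ρ^o/μ₀` agree to `e^{±Cλ²/L}`;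
  (A6′) `|F_il · μ₀ · √(n^o_ii n^o_ll) − G_il · λ₀ · √(n^f_ii n^f_ll)| ≤ C(λ²/L) · λ₀ μ₀ · √(n^f_ii n^f_ll) · √(n^o_ii n^o_ll)` — the NORMALISED symmetrised
        coupling defects `F/(λ₀√(n^f n^f))` and `G/(μ₀√(n^o n^o))` agree to `O(λ²/L)`.
Every clause is homogeneous of degree 0 under `u_i ↦ αu_i` and under `w_i ↦ γw_i` separately, and under `K ↦ cK` on each side.

* `ChannelUniversalityAt k` — the corrected (A);  `o6_transfer_normalised` (pure real);
* ★ `liftPositionR3_of_channelUniversality_pscalingExists : (∀ k, ChannelUniversalityAt k) → (∀ k, PScalingExistsAt k) → LiftPositionR3`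
  (constant `C_A + C_B`; no smallness of `λ` needed beyond the two inputs' levels).

HONEST FRAMING: typing + pure-real composition on the conditional femto rung R2b1; (A) is the OPEN field-theoretic universality, (B∃) the OPEN one-site
semiclassics; nothing here bears on infinite volume, the continuum limit or the Clay gap.  References: M. Lüscher, NPB 219 (1983) 233 [cite: Luscher1983, §3];
M. Lüscher, U. Wolff, NPB 339 (1990) 222 [cite: LuscherWolff1990].
-/

set_option autoImplicit false

noncomputable section

open MeasureTheory Filter Topology Real
open Literature.MathematicalPhysics.QuantumFieldTheory (GaugeConfig Site gaugeTransform)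
open scoped BigOperators

namespace Summit.QuantumFields.YangMills.Theorems.FemtoTransferGap.PolyakovLift

open Summit.QuantumFields.YangMills.Theorems.FemtoTransferGap

/-- **(A) `ChannelUniversalityAt k` — field-theoretic universality of the dressed flowed-Polyakov channel numbers, SCALE-FREE form**: for every lift
basis and all raw vacua, deep in the femto window, the fine numbers of `dressedLiftFamily β φ g` and the one-site numbers of
`shadowFamily (oneSiteCoupling β L) L e₀ g` satisfy (A5) agreement of the one-step effective ratios relative to the top values to `e^{±Cλ²/L}` and (A6′)
agreement of the NORMALISED symmetrised coupling defects to `O(λ²/L)` (product form, no division). [cite: Luscher1983, §3] [cite: LuscherWolff1990] -/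
def ChannelUniversalityAt (k : ℕ) : Prop :=
  ∃ C lam0 : ℝ, 0 ≤ C ∧ 0 < lam0 ∧ ∀ lam : ℝ, 0 < lam → lam ≤ lam0 → ∃ L0 : ℕ,
    ∀ (L : ℕ) [NeZero L], L0 ≤ L → ∀ β : ℝ, InFemtoWindow lam β L →
      ∀ φ : GaugeConfig 3 L SU2 → ℝ, IsRawVacuum β φ →
        ∀ (ω : GaugeConfig 3 1 SU2 → ℝ) (g : Fin k → (GaugeConfig 3 1 SU2 → ℝ)), LiftBasis (liftCoupling β L) k ω g →
          ∀ e₀ : GaugeConfig 3 1 SU2 → ℝ, IsRawVacuum (L := 1) (oneSiteCoupling β L) e₀ →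
            let u := dressedLiftFamily β φ g
            let w := shadowFamily (oneSiteCoupling β L) L e₀ g
            let l0 := levelValue su2Rep L β 0
            let m0 := levelValue su2Rep 1 (oneSiteCoupling β L) 0
            (∀ i : Fin k,
              l2 (u i) (transferApply β (u i)) * l2 (w i) (w i) * m0 ≤
                  Real.exp (C * luscherLambda β L ^ 2 / L) * (l2 (w i) (transferApply (oneSiteCoupling β L) (w i)) * l2 (u i) (u i) * l0) ∧
              l2 (w i) (transferApply (oneSiteCoupling β L) (w i)) * l2 (u i) (u i) * l0 ≤
                  Real.exp (C * luscherLambda β L ^ 2 / L) * (l2 (u i) (transferApply β (u i)) * l2 (w i) (w i) * m0)) ∧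
            (∀ i l : Fin k, i ≠ l →
              |(l2 (u i) (transferApply β (u l)) -
                  (l2 (u i) (transferApply β (u i)) / l2 (u i) (u i) + l2 (u l) (transferApply β (u l)) / l2 (u l) (u l)) / 2 *
                    l2 (u i) (u l)) * m0 * (Real.sqrt (l2 (w i) (w i)) * Real.sqrt (l2 (w l) (w l))) -
                (l2 (w i) (transferApply (oneSiteCoupling β L) (w l)) -
                  (l2 (w i) (transferApply (oneSiteCoupling β L) (w i)) / l2 (w i) (w i) +
                      l2 (w l) (transferApply (oneSiteCoupling β L) (w l)) / l2 (w l) (w l)) / 2 * l2 (w i) (w l)) * l0 *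
                  (Real.sqrt (l2 (u i) (u i)) * Real.sqrt (l2 (u l) (u l)))|
                ≤ C * (luscherLambda β L ^ 2 / L) * l0 * m0 *
                  (Real.sqrt (l2 (u i) (u i)) * Real.sqrt (l2 (u l) (u l))) * (Real.sqrt (l2 (w i) (w i)) * Real.sqrt (l2 (w l) (w l))))

/-- (A6′) transfer, pure real: `|F| ≤ (a + b)·λ₀·s_f` from `|F μ₀ s_o − G λ₀ s_f| ≤ a λ₀ μ₀ s_f s_o`, `|G| ≤ b μ₀ s_o`, `μ₀, s_o > 0`. [folklore] -/
theorem o6_transfer_normalised {F G m0 l0 a b sO sF : ℝ} (hm0 : 0 < m0) (hsO : 0 < sO) (hl0 : 0 ≤ l0) (hsF : 0 ≤ sF)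
    (hA : |F * m0 * sO - G * l0 * sF| ≤ a * l0 * m0 * sF * sO) (hB : |G| ≤ b * m0 * sO) :
    |F| ≤ (a + b) * l0 * sF := by
  have h1 : |F| * (m0 * sO) ≤ ((a + b) * l0 * sF) * (m0 * sO) := by
    have e : |F| * (m0 * sO) = |F * m0 * sO| := by
      rw [abs_mul, abs_mul, abs_of_pos hm0, abs_of_pos hsO]; ring
    calc |F| * (m0 * sO) = |F * m0 * sO| := e
      _ = |(F * m0 * sO - G * l0 * sF) + G * l0 * sF| := by ring_nf
      _ ≤ |F * m0 * sO - G * l0 * sF| + |G * l0 * sF| := abs_add_le _ _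
      _ ≤ a * l0 * m0 * sF * sO + b * m0 * sO * (l0 * sF) := by
          refine add_le_add hA ?_
          rw [abs_mul, abs_mul, abs_of_nonneg hl0, abs_of_nonneg hsF, mul_assoc]
          exact mul_le_mul_of_nonneg_right hB (mul_nonneg hl0 hsF)
      _ = ((a + b) * l0 * sF) * (m0 * sO) := by ring
  exact le_of_mul_le_mul_right h1 (mul_pos hm0 hsO)

/-- ★★ **(A) ∧ (B∃) ⟹ the r3 text of S-POS** (corrected universality): take the basis supplied by `PScalingExistsAt` at `Λ = λ(β,L)`, read
`ChannelUniversalityAt` for it, transfer (o5′) by `o5_transfer` and (o6′) by `o6_transfer_normalised`; constant `C_A + C_B`. [cite: Luscher1983, §3] -/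
theorem liftPositionR3_of_channelUniversality_pscalingExists (hA : ∀ k, ChannelUniversalityAt k) (hB : ∀ k, PScalingExistsAt k) :
    LiftPositionR3 := by
  intro k
  obtain ⟨CA, lA, hCA, hlA, hAk⟩ := hA k
  obtain ⟨CB, lB, hCB, hlB, hBk⟩ := hB k
  refine ⟨CA + CB, min lA lB, by positivity, lt_min hlA hlB, fun lam hlam hle => ?_⟩
  obtain ⟨LA, hLA⟩ := hAk lam hlam (hle.trans (min_le_left _ _))
  obtain ⟨LB, hLB⟩ := hBk lam hlam (hle.trans (min_le_right _ _))
  refine ⟨max LA LB, fun L _ hL β hW φ hφ => ?_⟩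
  have hleA : LA ≤ L := (le_max_left _ _).trans hL
  have hleB : LB ≤ L := (le_max_right _ _).trans hL
  have hβ0 : 0 ≤ β := zero_le_one.trans hW.1
  have hΛpos : 0 < luscherLambda β L := luscherLambda_pos_of_window hlam hW
  have hLpos : (0 : ℝ) < L := Nat.cast_pos.mpr (NeZero.pos L)
  have hBpos : 0 < oneSiteCoupling β L := by
    unfold oneSiteCoupling; exact div_pos (mul_pos two_pos (pow_pos hLpos 3)) (pow_pos hΛpos 3)
  obtain ⟨e₀, θ, c, he₀, -, -, hn₀, heig₀, -, -, -⟩ := PhysL2.exists_groundState (L := 1) (oneSiteCoupling β L)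
  have heig₀' : transferApply (oneSiteCoupling β L) e₀ = levelValue su2Rep 1 (oneSiteCoupling β L) 0 • e₀ := by
    rw [levelValue_zero]; exact heig₀
  have hvac₀ : IsRawVacuum (L := 1) (oneSiteCoupling β L) e₀ := ⟨he₀, hn₀, heig₀'⟩
  obtain ⟨ω, g, hbasis, hB0, hB5, hB6⟩ := hLB L hleB (luscherLambda β L) hW.2.1 hW.2.2 e₀ hvac₀
  have hbasis' : LiftBasis (liftCoupling β L) k ω g := hbasis
  obtain ⟨hA5, hA6⟩ := hLA L hleA β hW φ hφ ω g hbasis' e₀ hvac₀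
  set u := dressedLiftFamily β φ g with hu
  set w := shadowFamily (oneSiteCoupling β L) L e₀ g with hw
  set l0 := levelValue su2Rep L β 0 with hl0
  set m0 := levelValue su2Rep 1 (oneSiteCoupling β L) 0 with hm0
  have hm0pos : 0 < m0 := levelValue_su2Rep_pos (L := 1) hBpos 0
  have hl0nn : 0 ≤ l0 := levelValue_su2Rep_nonneg L hβ0 0
  have huP : ∀ i, IsPhys (u i) := fun i => isPhys_dressedLiftVec β hφ.1 (hbasis'.2.2.2.2.1 i)
  have hEA : 0 < Real.exp (CA * luscherLambda β L ^ 2 / L) := Real.exp_pos _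
  have hEB : 0 < Real.exp (CB * luscherLambda β L ^ 2 / L) := Real.exp_pos _
  have hEE : Real.exp (CA * luscherLambda β L ^ 2 / L) * Real.exp (CB * luscherLambda β L ^ 2 / L) =
      Real.exp ((CA + CB) * luscherLambda β L ^ 2 / L) := by
    rw [← Real.exp_add]; congr 1; ring
  refine ⟨ω, g, hbasis', fun i => ?_, fun i l hil => ?_⟩
  · obtain ⟨h1, h2⟩ := o5_transfer (hB0 i) hm0pos (l2_self_nonneg (u i)) hl0nn hEA hEB (hA5 i).1 (hA5 i).2 (hB5 i).1 (hB5 i).2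
    rw [hEE] at h1 h2
    exact ⟨h1, h2⟩
  · have hsO : 0 < Real.sqrt (l2 (w i) (w i)) * Real.sqrt (l2 (w l) (w l)) :=
      mul_pos (Real.sqrt_pos.mpr (hB0 i)) (Real.sqrt_pos.mpr (hB0 l))
    have hsF : 0 ≤ Real.sqrt (l2 (u i) (u i)) * Real.sqrt (l2 (u l) (u l)) := mul_nonneg (Real.sqrt_nonneg _) (Real.sqrt_nonneg _)
    have h := o6_transfer_normalised (a := CA * (luscherLambda β L ^ 2 / L)) (b := CB * (luscherLambda β L ^ 2 / L)) hm0pos hsO hl0nn hsF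
      (hA6 i l hil) (hB6 i l hil)
    calc _ ≤ (CA * (luscherLambda β L ^ 2 / L) + CB * (luscherLambda β L ^ 2 / L)) * l0 *
            (Real.sqrt (l2 (u i) (u i)) * Real.sqrt (l2 (u l) (u l))) := h
      _ = (CA + CB) * (luscherLambda β L ^ 2 / L) * l0 * (Real.sqrt (l2 (u i) (u i)) * Real.sqrt (l2 (u l) (u l))) := by ring

end Summit.QuantumFields.YangMills.Theorems.FemtoTransferGap.PolyakovLift

end
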